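/-
Copyright (c) 2026 the pub-hodgecm-mathlib formalisation cell (harness21).  Prover seat hodgecm-mathlib-F0P2-p08 (g3), Track B «K2-LIT»,
#184♮ = hLiu418 = `stmt-HodgeConjecture-24832`; socket #41 `sig_K2LiuSiegelEisensteinContinuation`, KIND W, brick (KW-J′): the `hJ` letter of ★ `kindW_block_of_record`
COFINITELY — the good-place kit of ★ (KW-J) `hJ_of_isGoodPlace` discharged for a splitting character, in particular for the TOP's `μ̃ = toHeckeCharacter L λ⁻¹`.
THEOREMS ONLY (no `def`, no `instance`, no notation, no named-fact hypothesis, no `sorry`).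
-/
import Summits.HodgeConjecture.HodgeConjecture.Theorems.K2LiuKindWGoodPlaceFactor          -- ★ (KW-J) `hJ_of_isGoodPlace` (this seat)
import Summits.HodgeConjecture.HodgeConjecture.Theorems.K2LiuKindOneLineGoodPlaceLetters    -- ★ (KW1-g) `prod_localComponent_mk0_toPlace_eq_valueAtUniformizer` (the parity letter from the restriction letter)
import Summits.HodgeConjecture.HodgeConjecture.Theorems.K2LiuConjugateSymplecticInv         -- ★ `IsConjugateSymplectic.inv`
import Literature.RepresentationTheory.HarrisKudlaSweet1996.SplittingCharactersCM           -- ★ `isSplittingChar_toHeckeCharacter_iff_isConjugateSymplectic`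
import Literature.NumberTheory.GaloisRepresentations.FrobeniusDensityTheorem                -- ★ `finite_setOf_not_isUnramifiedIn`
import Literature.NumberTheory.Automorphic.IdeleClassCharacterHecke                         -- ★ `toHeckeCharacter`, `isUnitary_toHeckeCharacter`
import HarnessLib

/-!
# Crux `HLiu418`, socket #41, KIND W — brick (KW-J′) `K2LiuKindWGoodPlaceFactorCofinite`: THE `hJ` LETTER OF ★ `kindW_block_of_record`, COFINITELY,
# for a character with `χ|_{𝕀_{L⁺}} = ε_{L∕L⁺}` — in particular for the TOP's `μ̃ = toHeckeCharacter L λ⁻¹`, `λ` conjugate symplectic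

Cell `hodgecm-mathlib`, crux item hLiu418 = `stmt-HodgeConjecture-24832` (helper lane `--supports … --as helper`, count-neutral), route of record
`HCCMUnconditional`; squad K2 ∕ K2Liu, road `K2_Liu`, socket #41, KIND W; KW desk of record F0P2-p08 (g3) (LEAD F0P6-plan (g14) BATCH #157 (4)).
★ (KW-J) `K2LiuKindWGoodPlaceFactor.hJ_of_isGoodPlace` pays the binder `hJ` of ★ `K2LiuSiegelEisensteinKindWOfRecord.kindW_block_of_record` (and of its ★ `_local` ∕ `_cm` twins)
modulo a PER-PLACE KIT off `T₀`: `IsGoodPlace` (★ `LocalSplitting.IsGoodPlace`), `v` unramified in `L∕L⁺`, and the parity letter `∏_{w∣v} χ_w(ι_w ϖ_v) = ε(ϖ_v)`.  THIS FILE removes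
the kit: every letter holds for ALL BUT FINITELY MANY `v` once `χ` restricts to `ε_{L∕L⁺} = quadraticHeckeCharCM L` on `𝕀_{L⁺}` (the restriction letter `hε`; ★ (KW1-g)
`prod_localComponent_mk0_toPlace_eq_valueAtUniformizer` turns it into the parity letter at every place where `χ` is unramified; ★ `LocalSplitting.eventually_isGoodPlace`; ★
`finite_setOf_not_isUnramifiedIn`), and for the TOP's `χ = toHeckeCharacter L λ⁻¹` with `λ` CONJUGATE SYMPLECTIC the restriction letter is ★ (`λ⁻¹` is conjugate symplectic,
★ `IsConjugateSymplectic.inv`; ★ `isSplittingChar_toHeckeCharacter_iff_isConjugateSymplectic` at `m = 1`) and unitarity is ★ `isUnitary_toHeckeCharacter`.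
* §1 `isSplittingChar_one_toHeckeCharacter_inv` (the restriction letter of `μ̃`); **`eventually_kindW_goodPlaceKit`** — `∀ᶠ v in cofinite`: `IsGoodPlace …`, `v` unramified in `L`,
  `χ` unramified above `v`, and the parity letter at `ϖ_v := HeckeCharacter.uniformizer L⁺ v` (inputs: `hχ` off a finite `T₀`, `hε`).
* §2 **`exists_finset_hJ`** — `∃ U₁ ⊇ T₀` off which the `hJ` binder of ★ `kindW_block_of_record` holds VERBATIM (`n := 2`, `T₀ := U₁`), from `(νv) (hνK) (hχ) (hχu) (hε)` only;
  **`exists_finset_hJ_toHeckeCharacter`** — the same for `χ := toHeckeCharacter L λ⁻¹`, `λ` conjugate symplectic: NO by-value letter left (the socket's own `lam hlam` and the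
  head's own `hχ`).  All carrier letters of the KW head are monotone in `T₀`, so the tie takes `T₀ := U₁`.
[Liu2011, §2A (2-10)] [Shimura1997, §18.1 (18.4)] [GelbartRogawski1991, §3.1 (3.1.3)] [Liu2021, Def. 4.1, Rem. 4.4] [HarrisKudlaSweet1996, (1.5)].
HONEST LABEL.  Count-neutral helper; closes no socket by itself: `HC_CM` is proved only modulo the 7 printed citations (2 remaining named inputs:
hLiu418 = `stmt-HodgeConjecture-24832`, h413 = `stmt-HodgeConjecture-24833`) until rung 0 closes.

## References
* [Liu2011] Y. Liu, Algebra Number Theory 5 (2011): §2A p. 936 (2-10).   * [Shimura1997] G. Shimura, CBMS 93 (1997): §18.1 (18.4).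
* [GelbartRogawski1991] S. Gelbart, J. Rogawski, Invent. Math. 105 (1991): §3.1 (3.1.3).   * [Liu2021] Y. Liu, Invent. Math. 228 (2022) ∕ arXiv:1710.11492: Def. 4.1, Rem. 4.4.
* [HarrisKudlaSweet1996] M. Harris, S. Kudla, W. J. Sweet, J. AMS 9 (1996): (1.5), §6 (6.16).   * [CasselsFrohlichANT1967] Cassels–Fröhlich (1967): Ch. XV (Tate) §4.1.
-/

set_option autoImplicit false
-- the mandated namespace repeats the single-problem summit's segment (`HodgeConjecture.HodgeConjecture`)
set_option linter.dupNamespace false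

noncomputable section

open scoped Matrix ComplexConjugate NNReal ENNReal
open NumberField IsDedekindDomain Matrix MeasureTheory Measure Set Filter
open Literature.NumberTheory.Automorphic Literature.NumberTheory.Automorphic.UnitaryGroup Literature.NumberTheory.GaloisRepresentations
open Literature.NumberTheory.LFunctions
open Literature.NumberTheory.GelbartRogawski1991 Literature.NumberTheory.GelbartRogawski1991.GRConstruction
open Literature.NumberTheory.GelbartRogawski1991.UnitaryDualPair
open Literature.NumberTheory.K2Lit Literature.NumberTheory.K2Lit.SiegelDoubled Literature.NumberTheory.K2Lit.PlaceSplitting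
open Literature.NumberTheory.Automorphic.IdeleClassGroup (toHeckeCharacter isUnitary_toHeckeCharacter IsConjugateSymplectic)
open Literature.RepresentationTheory.HarrisKudlaSweet1996 (IsSplittingChar isSplittingChar_toHeckeCharacter_iff_isConjugateSymplectic)
open Literature.Topology.Algebra.RestrictedProduct (inH)
open Summit.HodgeConjecture.HodgeConjecture.Cruxes.HLiu418.K2LiuSiegelUnipotentFourierDefs
open Summit.HodgeConjecture.HodgeConjecture.Cruxes.HLiu418.K2LiuSiegelUnipotentLocalDefs
open Summit.HodgeConjecture.HodgeConjecture.Cruxes.HLiu418.K2LiuSiegelEisensteinKindWLetters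
open Summit.HodgeConjecture.HodgeConjecture.Cruxes.HLiu418.K2LiuKindWGoodPlaceFactor (hJ_of_isGoodPlace)
open Summit.HodgeConjecture.HodgeConjecture.Cruxes.HLiu418.K2LiuKindOneLineGoodPlaceLetters (prod_localComponent_mk0_toPlace_eq_valueAtUniformizer)
open Summit.HodgeConjecture.HodgeConjecture.Cruxes.HLiu418.K2LiuConjugateSymplecticInv (IsConjugateSymplectic.inv)

namespace Summit.HodgeConjecture.HodgeConjecture.Cruxes.HLiu418.K2LiuKindWGoodPlaceFactorCofinite

variable (L : Type) [Field L] [NumberField L] [IsCMField L]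
variable {N M : ℕ} (e : Fin N × Fin M ≃ Fin 2)
  (dV : Fin N → L) (hdV : ∀ i, IsCMField.complexConj L (dV i) = dV i)
  (dW : Fin M → L) (hdW : ∀ i, IsCMField.complexConj L (dW i) = dW i)
  (hdV0 : ∀ i, dV i ≠ 0) (hdW0 : ∀ i, dW i ≠ 0)

/-! ## §1 The restriction letter of `μ̃` and the good-place kit, cofinitely -/

/-- **the restriction letter of the TOP's `μ̃`**: for `λ` conjugate symplectic, `toHeckeCharacter L λ⁻¹` restricts to `ε_{L∕L⁺}` on `𝕀_{L⁺}` (`λ⁻¹` is conjugate symplectic,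
★ `IsConjugateSymplectic.inv`; ★ `isSplittingChar_toHeckeCharacter_iff_isConjugateSymplectic` at `m = 1`). [cite: Liu2021, Def. 4.1, Rem. 4.4] [cite: HarrisKudlaSweet1996, (1.5)] -/
theorem isSplittingChar_one_toHeckeCharacter_inv (lam : IdeleClassGroup L →ₜ* Circle) (hlam : IsConjugateSymplectic L lam) (x : ideleGroup (Fp L)) :
    toHeckeCharacter L lam⁻¹ (AdeleRing.ideleBaseChange (Fp L) L x) = quadraticHeckeCharCM L x := by
  have h := (isSplittingChar_toHeckeCharacter_iff_isConjugateSymplectic (L := L) odd_one lam⁻¹).2 (IsConjugateSymplectic.inv hlam) x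
  rwa [pow_one] at h

include hdV0 hdW0 in
/-- **THE GOOD-PLACE KIT OF ★ (KW-J), COFINITELY.**  For a Hecke character `χ` of `L` unramified above every `v ∉ T₀` (`T₀` finite) with `χ|_{𝕀_{L⁺}} = ε_{L∕L⁺}` (`hε`): for all
but finitely many finite places `v` of `L⁺` — `IsGoodPlace (L⁺, L, δ = imagUnit L, v, 2, gramR, χ_w)` (★ `eventually_isGoodPlace`: `δ ≠ 0`, `det gramR` a unit, `χ_w` unramified
cofinitely), `v` is unramified in `L` (★ `finite_setOf_not_isUnramifiedIn`), `χ` is unramified above `v`, and the parity letter `∏_{w∣v} χ_w(ι_w ϖ_v) = ε(ϖ_v)` holds at the chosen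
uniformiser (★ `prod_localComponent_mk0_toPlace_eq_valueAtUniformizer`). [cite: GelbartRogawski1991, §3.1 (3.1.3)] [cite: CasselsFrohlichANT1967, Ch. XV (Tate) §4.1] -/
theorem eventually_kindW_goodPlaceKit (T₀ : Finset (HeightOneSpectrum (𝓞 (Fp L)))) {χ : HeckeCharacter L}
    (hχ : ∀ v, v ∉ T₀ → ∀ w' : UnitaryGroup.PlacesOver L v, χ.IsUnramifiedAt w'.1)
    (hε : ∀ x : ideleGroup (Fp L), χ (AdeleRing.ideleBaseChange (Fp L) L x) = quadraticHeckeCharCM L x) :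
    ∀ᶠ v : HeightOneSpectrum (𝓞 (Fp L)) in cofinite,
      LocalSplitting.IsGoodPlace (Fp L) L (imagUnit L) v 2 (gramR L e dV hdV dW hdW) (fun w => χ.localComponent w.1) ∧
      Algebra.IsUnramifiedIn (𝓞 L) v.asIdeal ∧ (∀ w' : UnitaryGroup.PlacesOver L v, χ.IsUnramifiedAt w'.1) ∧
      (((∏ w : UnitaryGroup.PlacesOver L v, χ.localComponent w.1
        (Units.mk0 (toPlace v w (HeckeCharacter.uniformizer (Fp L) v : v.adicCompletion (Fp L)))
          ((map_ne_zero (toPlace v w)).2 (HeckeCharacter.uniformizer (Fp L) v).ne_zero))) : ℂˣ) : ℂ) = (quadraticHeckeCharCM L).valueAtUniformizer v := by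
  -- `χ` is unramified above every `v ∉ T₀`
  have hχ' : ∀ᶠ v : HeightOneSpectrum (𝓞 (Fp L)) in cofinite, ∀ w' : UnitaryGroup.PlacesOver L v, χ.IsUnramifiedAt w'.1 :=
    T₀.eventually_cofinite_notMem.mono fun v hv => hχ v hv
  -- ★ `eventually_isGoodPlace`
  have hgood := LocalSplitting.eventually_isGoodPlace (Fp L) L (imagUnit L) 2 (gramR L e dV hdV dW hdW) (imagUnit_ne_zero L)
    (isUnit_det_gramR₀ L e dV hdV hdV0 dW hdW hdW0) (fun v (w : UnitaryGroup.PlacesOver L v) => χ.localComponent w.1)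
    (hχ'.mono fun v hv w u hu => (hv w).localComponent_eq_one_of_valuation_eq_one hu)
  -- ramification is finite
  have hunr : ∀ᶠ v : HeightOneSpectrum (𝓞 (Fp L)) in cofinite, Algebra.IsUnramifiedIn (𝓞 L) v.asIdeal :=
    Filter.eventually_cofinite.2 (finite_setOf_not_isUnramifiedIn (Fp L) L)
  filter_upwards [hgood, hunr, hχ'] with v hg hu hc
  exact ⟨hg, hu, hc, prod_localComponent_mk0_toPlace_eq_valueAtUniformizer L v χ (quadraticHeckeCharCM L) hε hc
    (HeckeCharacter.valued_uniformizer (K := Fp L) v) _⟩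

/-! ## §2 The letter `hJ` of ★ `kindW_block_of_record` off a finite set, with no per-place kit -/

section Head

variable [∀ v : HeightOneSpectrum (𝓞 (Fp L)), MeasurableSpace ↥(unipDeltaLoc L e dV hdV dW hdW v)]
  [∀ v : HeightOneSpectrum (𝓞 (Fp L)), BorelSpace ↥(unipDeltaLoc L e dV hdV dW hdW v)]

include hdV0 hdW0 in
/-- **THE `hJ` LETTER OF ★ `kindW_block_of_record`, OFF A FINITE SET `U₁ ⊇ T₀`, FOR A CHARACTER RESTRICTING TO `ε_{L∕L⁺}`.**  Inputs: the carriers `νv` with ★ G1's normalisation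
`hνK`; `χ` unramified above every `v ∉ T₀` (`hχ`), unitary (`hχu`), with the restriction letter `hε : χ|_{𝕀_{L⁺}} = quadraticHeckeCharCM L`.  THEN there is a finite `U₁ ⊇ T₀` such that
★ p862959's binder `hJ` holds VERBATIM at `T₀ := U₁` (`n := 2`): for every non-singular skew index `S`, every `h`, every `s` with `2∕2 < re s` and every `v ∉ kindWPlaces ↑U₁ ↑S h`,
`∫ conj ψ_S(ι_v y)·Λ_{s,v}((w_Δ)_v y) d(νv v)(y) = (1 − q_v^{−(2s+1)})(1 − ε(ϖ_v) q_v^{−(2s+2)})` — §1 ∘ ★ (KW-J) `hJ_of_isGoodPlace`.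
[cite: Liu2011, §2A (2-10)] [cite: Shimura1997, §18.1 (18.4)] [cite: GelbartRogawski1991, §3.1 (3.1.3)] -/
theorem exists_finset_hJ (T₀ : Finset (HeightOneSpectrum (𝓞 (Fp L))))
    (νv : ∀ v : HeightOneSpectrum (𝓞 (Fp L)), Measure ↥(unipDeltaLoc L e dV hdV dW hdW v)) [∀ v, (νv v).IsHaarMeasure]
    (hνK : ∀ v, νv v (((inH (fun v => UnitaryGroup.localInt L (IsCMField.complexConj L) (2 + 2) (hermD L e dV hdV dW hdW) v)
      (fun v => unipDeltaLoc L e dV hdV dW hdW v) v) : Subgroup ↥(unipDeltaLoc L e dV hdV dW hdW v)) : Set ↥(unipDeltaLoc L e dV hdV dW hdW v)) = 1)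
    {χ : HeckeCharacter L} (hχ : ∀ v, v ∉ T₀ → ∀ w' : UnitaryGroup.PlacesOver L v, χ.IsUnramifiedAt w'.1) (hχu : χ.IsUnitary)
    (hε : ∀ x : ideleGroup (Fp L), χ (AdeleRing.ideleBaseChange (Fp L) L x) = quadraticHeckeCharCM L x) :
    ∃ U₁ : Finset (HeightOneSpectrum (𝓞 (Fp L))), T₀ ⊆ U₁ ∧
    ∀ (S : skewMatrices ((IsCMField.complexConj L : L ≃ₐ[Fp L] L) : L →+* L) ((gramR L e dV hdV dW hdW).map (algebraMap (Fp L) L))) (h : HA L e dV hdV dW hdW) (s : ℂ),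
      ((2 : ℕ) : ℝ) / 2 < s.re → (S : Matrix (Fin 2) (Fin 2) L).det ≠ 0 →
      ∀ v, v ∉ kindWPlaces L e dV hdV dW hdW (U₁ : Set (HeightOneSpectrum (𝓞 (Fp L)))) (S : Matrix (Fin 2) (Fin 2) L) h →
        ∫ y, conj (unipDeltaChar L e dV hdV dW hdW (S : Matrix (Fin 2) (Fin 2) L)
              (locToAdelic L e dV hdV dW hdW v (y : UnitaryGroup.localPi L (IsCMField.complexConj L) (2 + 2) (hermD L e dV hdV dW hdW) v)) : ℂ) *
            LambdaLoc L e dV hdV dW hdW v χ s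
              (UnitaryGroup.evalPlace (Fp L) L (IsCMField.complexConj L) (2 + 2) (hermD L e dV hdV dW hdW) v
                  (UnitaryGroup.finPart (Fp L) L (IsCMField.complexConj L) (2 + 2) (hermD L e dV hdV dW hdW) (SiegelDoubled.weylDelta L e dV hdV dW hdW)) *
                (y : UnitaryGroup.localPi L (IsCMField.complexConj L) (2 + 2) (hermD L e dV hdV dW hdW) v)) ∂(νv v) =
          (1 - (v.residueCard : ℂ) ^ (-(2 * s + 1))) * (1 - (quadraticHeckeCharCM L).valueAtUniformizer v * (v.residueCard : ℂ) ^ (-(2 * s + 2))) := by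
  classical
  have hkit := eventually_kindW_goodPlaceKit L e dV hdV dW hdW hdV0 hdW0 T₀ hχ hε
  set B : Finset (HeightOneSpectrum (𝓞 (Fp L))) := (Filter.eventually_cofinite.1 hkit).toFinset with hB
  have hBspec : ∀ v, v ∉ B →
      LocalSplitting.IsGoodPlace (Fp L) L (imagUnit L) v 2 (gramR L e dV hdV dW hdW) (fun w => χ.localComponent w.1) ∧
      Algebra.IsUnramifiedIn (𝓞 L) v.asIdeal ∧ (∀ w' : UnitaryGroup.PlacesOver L v, χ.IsUnramifiedAt w'.1) ∧
      (((∏ w : UnitaryGroup.PlacesOver L v, χ.localComponent w.1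
        (Units.mk0 (toPlace v w (HeckeCharacter.uniformizer (Fp L) v : v.adicCompletion (Fp L)))
          ((map_ne_zero (toPlace v w)).2 (HeckeCharacter.uniformizer (Fp L) v).ne_zero))) : ℂˣ) : ℂ) = (quadraticHeckeCharCM L).valueAtUniformizer v := by
    intro v hv
    by_contra h
    exact hv ((Set.Finite.mem_toFinset _).2 h)
  refine ⟨T₀ ∪ B, Finset.subset_union_left, ?_⟩
  have hout : ∀ v, v ∉ T₀ ∪ B → v ∉ T₀ ∧ v ∉ B := fun v hv => by rwa [Finset.mem_union, not_or] at hv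
  exact hJ_of_isGoodPlace L e dV hdV dW hdW hdV0 hdW0 (T₀ ∪ B) νv hνK (fun v hv => (hBspec v (hout v hv).2).2.2.1) hχu
    (fun v hv => (hBspec v (hout v hv).2).1) (fun v hv => (hBspec v (hout v hv).2).2.1) (fun v hv => (hBspec v (hout v hv).2).2.2.2)

include hdV0 hdW0 in
/-- **THE `hJ` LETTER OF ★ `kindW_block_of_record` FOR THE TOP's `μ̃ = toHeckeCharacter L λ⁻¹`, `λ` CONJUGATE SYMPLECTIC, OFF A FINITE SET `U₁ ⊇ T₀` — NO BY-VALUE LETTER LEFT**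
(the socket's own `lam hlam`, the head's own `hχ`; unitarity ★ `isUnitary_toHeckeCharacter`, restriction §1 `isSplittingChar_one_toHeckeCharacter_inv`).  At the tie: take the
head's `T₀ := U₁` (every carrier letter of ★ `kindW_block_of_record` is monotone in `T₀`) and `hJ :=` the second component.
[cite: Liu2011, §2A (2-10)] [cite: Shimura1997, §18.1 (18.4)] [cite: GelbartRogawski1991, §3.1 (3.1.3)] [cite: Liu2021, Def. 4.1, Rem. 4.4] -/
theorem exists_finset_hJ_toHeckeCharacter (lam : IdeleClassGroup L →ₜ* Circle) (hlam : IsConjugateSymplectic L lam) (T₀ : Finset (HeightOneSpectrum (𝓞 (Fp L))))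
    (νv : ∀ v : HeightOneSpectrum (𝓞 (Fp L)), Measure ↥(unipDeltaLoc L e dV hdV dW hdW v)) [∀ v, (νv v).IsHaarMeasure]
    (hνK : ∀ v, νv v (((inH (fun v => UnitaryGroup.localInt L (IsCMField.complexConj L) (2 + 2) (hermD L e dV hdV dW hdW) v)
      (fun v => unipDeltaLoc L e dV hdV dW hdW v) v) : Subgroup ↥(unipDeltaLoc L e dV hdV dW hdW v)) : Set ↥(unipDeltaLoc L e dV hdV dW hdW v)) = 1)
    (hχ : ∀ v, v ∉ T₀ → ∀ w' : UnitaryGroup.PlacesOver L v, (toHeckeCharacter L lam⁻¹).IsUnramifiedAt w'.1) :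
    ∃ U₁ : Finset (HeightOneSpectrum (𝓞 (Fp L))), T₀ ⊆ U₁ ∧
    ∀ (S : skewMatrices ((IsCMField.complexConj L : L ≃ₐ[Fp L] L) : L →+* L) ((gramR L e dV hdV dW hdW).map (algebraMap (Fp L) L))) (h : HA L e dV hdV dW hdW) (s : ℂ),
      ((2 : ℕ) : ℝ) / 2 < s.re → (S : Matrix (Fin 2) (Fin 2) L).det ≠ 0 →
      ∀ v, v ∉ kindWPlaces L e dV hdV dW hdW (U₁ : Set (HeightOneSpectrum (𝓞 (Fp L)))) (S : Matrix (Fin 2) (Fin 2) L) h →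
        ∫ y, conj (unipDeltaChar L e dV hdV dW hdW (S : Matrix (Fin 2) (Fin 2) L)
              (locToAdelic L e dV hdV dW hdW v (y : UnitaryGroup.localPi L (IsCMField.complexConj L) (2 + 2) (hermD L e dV hdV dW hdW) v)) : ℂ) *
            LambdaLoc L e dV hdV dW hdW v (toHeckeCharacter L lam⁻¹) s
              (UnitaryGroup.evalPlace (Fp L) L (IsCMField.complexConj L) (2 + 2) (hermD L e dV hdV dW hdW) v
                  (UnitaryGroup.finPart (Fp L) L (IsCMField.complexConj L) (2 + 2) (hermD L e dV hdV dW hdW) (SiegelDoubled.weylDelta L e dV hdV dW hdW)) *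
                (y : UnitaryGroup.localPi L (IsCMField.complexConj L) (2 + 2) (hermD L e dV hdV dW hdW) v)) ∂(νv v) =
          (1 - (v.residueCard : ℂ) ^ (-(2 * s + 1))) *
            (1 - (quadraticHeckeCharCM L).valueAtUniformizer v * (v.residueCard : ℂ) ^ (-(2 * s + 2))) :=
  exists_finset_hJ L e dV hdV dW hdW hdV0 hdW0 T₀ νv hνK hχ (isUnitary_toHeckeCharacter L lam⁻¹) (isSplittingChar_one_toHeckeCharacter_inv L lam hlam)

end Head

end Summit.HodgeConjecture.HodgeConjecture.Cruxes.HLiu418.K2LiuKindWGoodPlaceFactorCofinite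

end
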